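import Summits.Ventures.YMGap.RobustBall.CovarianceLipschitzS
import Summits.Ventures.YMGap.RobustBall.DirectionalSusceptibilityS
import HarnessLib

/-!
# Venture YMGap, track ROBUST-BALL (Y2) — TIER 2: THE SUSCEPTIBILITY SERIES IS HÖLDER-½ IN THE ACTION, UNIFORMLY ON THE WEIGHTED BALL AND
# UNIFORMLY IN THE DIRECTION

HONEST FRAMING. WHAT THIS IS: a venture file (cell `pub-ymgap`, track Y2 ROBUST-BALL, seat rb-p1, theorems only), composing the Lipschitz
dependence of connected correlations on the action (`CovarianceLipschitzS.lean`: `|cov_{μ'}(f,g) − cov_μ(f,g)| ≤ 4N min(η,4)/(1−ρ) Σδ_f Σδ_g`)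
with the covariance decay and the susceptibility series of `DirectionalSusceptibilityS.lean` (`|cov_μ(f, g)| ≤ 8N Σδ_f Σδ_g e^{−t d(Δ_f,Δ_g)}`,
`Σ_X |cov_μ(F, V_X)| < ∞`) inside the one-link pair door `ρ := 6(d−1)|β| e^{a} e^{t} √(cv) + e^{a/2} √c Λ_t < 1` on `MemBallZdS a Λ_t t`:
* ★★ `abs_tsum_cov_sub_tsum_cov_le_S` — `t > 0`; members `W` and `W + V'` of the ball, modification `V' ∈ MemBallZdS η Λ_η t`; `μ`, `μ'` any
  DLR states of `W`, `W + V'`; observable `F` (local on `Λ_F`, Frobenius-Lipschitz vector `δ_F`); direction `V` (measurable bounded own-link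
  terms with Frobenius-Lipschitz witnesses of total load `≤ L` through every link).  Then the termwise differences are summable and
  `|Σ'_X cov_{μ'}(F, V_X) − Σ'_X cov_μ(F, V_X)| ≤ 8N (Σ_{Λ_F} δ_F) · √(min(η,4)/(1 − ρ)) · L · #Λ_F · d · ((1 + r)/(1 − r))^d`, `r = e^{−t/(2d)}`:
  termwise the minimum of the decay bound and of the Lipschitz bound is at most their geometric mean, which decays at HALF the weight
  and carries `√η`.  Since `−Σ'_X cov_{μ_{W+sV}}(F, V_X)` is the derivative of the state along the line `W + sV` (`StateDerivativeOnBallS`),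
  this is the modulus of continuity of the derivative of the state map in the base point, UNIFORM IN THE DIRECTION — the estimate behind
  the uniform first-order Taylor bound (Fréchet-type differentiability in the load seminorms) of `StateTaylorRemainderS.lean`;
* `su2_abs_tsum_cov_sub_tsum_cov_le_dim4` — `SU(2)`, `ℤ⁴`, hypothesis-free on `MemBallZdS a Λ t` against modifications in `MemBallZdS η Λ_η t`
  under `6|β_W| e^{a+η} e^{t} + e^{(a+η)/2} √(2/3) (Λ + Λ_η) < 1`: constant `16 (#Λ_F K_F) √(min(η,4)/(1−ρ')) L · #Λ_F · 4((1+e^{−t/8})/(1−e^{−t/8}))⁴`.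
WHAT THIS IS NOT: a `C²` statement or analyticity (the modulus is Hölder-½, from interpolation, not from a third-cumulant bound); one-sided
Dobrushin-comparison constants at lattice strong coupling; nothing about the continuum limit or a Clay-sense mass gap.
-/

noncomputable section

open MeasureTheory Function Finset ProbabilityTheory Real
open scoped NNReal
open Literature.Probability.LatticeModels
open Literature.Probability.LatticeModels.DobrushinMetric
open Literature.MathematicalPhysics.QuantumLattice
open Literature.MathematicalPhysics.QuantumFieldTheory hiding ZdEdge
open Summit.QuantumFields.BalabanUV.InfraRed.StrongCouplingPoincareDoorSUN (oneLinkPoincareSUN_two_sharp)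

namespace Summit.Ventures.YMGap.RobustBall

variable {d N : ℕ}

section SUN

variable {W V' V : Potential (ZdEdge d) (Matrix.specialUnitaryGroup (Fin N) ℂ)}

/-- ★★ **THE SUSCEPTIBILITY SERIES IS HÖLDER-½ IN THE ACTION, uniformly on the weighted ball and uniformly in the direction.**  `t > 0`;
members `W` and `W + V'` of `MemBallZdS a Λ_t t` inside the pair door `ρ < 1`; modification `V' ∈ MemBallZdS η Λ_η t` (oscillation load
`≤ η`); `μ` any DLR state of `W`, `μ'` ANY DLR state of `W + V'`; observable `F` (measurable, local on `Λ_F`, bounded, Frobenius-Lipschitz vector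
`δ_F`); direction `V` (measurable bounded own-link terms, Frobenius-Lipschitz witnesses `lipV_X` with total load `Σ'_{X∋e} Σ_{y∈X} lipV_X y ≤ L`
through every link).  Then `X ↦ |cov_{μ'}(F, V_X) − cov_μ(F, V_X)|` is summable and
`|Σ'_X cov_{μ'}(F, V_X) − Σ'_X cov_μ(F, V_X)| ≤ 8N (Σ_{Λ_F} δ_F) · √(min(η,4)/(1−ρ)) · L · #Λ_F · d · ((1 + e^{−t/(2d)})/(1 − e^{−t/(2d)}))^d`. -/
theorem abs_tsum_cov_sub_tsum_cov_le_S (hd : 1 ≤ d) (hN : 1 ≤ N) {β b c v a Λt t : ℝ}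
    (hc : 0 ≤ c) (hv : 0 ≤ v) (hb : |β| * (2 * ((d : ℝ) - 1)) ≤ b)
    (hP : ∀ B : Matrix (Fin N) (Fin N) ℂ, matrixOpNorm B ≤ b →
      ∀ (ψ : Matrix.specialUnitaryGroup (Fin N) ℂ → ℝ) (M : ℝ), 0 ≤ M →
        (∀ x y, |ψ x - ψ y| ≤ M * suFrobDist x y) →
        Var[ψ; (haarProbability (Matrix.specialUnitaryGroup (Fin N) ℂ)).tilted
          fun g => (N : ℝ) * ((g : Matrix (Fin N) (Fin N) ℂ) * B).trace.re] ≤ c * M ^ 2)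
    (hVB : ∀ B : Matrix (Fin N) (Fin N) ℂ, matrixOpNorm B ≤ b → ∀ Δ : Matrix (Fin N) (Fin N) ℂ,
      Var[fun g : Matrix.specialUnitaryGroup (Fin N) ℂ =>
          (N : ℝ) * ((g : Matrix (Fin N) (Fin N) ℂ) * Δ).trace.re;
        (haarProbability (Matrix.specialUnitaryGroup (Fin N) ℂ)).tilted
          fun g => (N : ℝ) * ((g : Matrix (Fin N) (Fin N) ℂ) * B).trace.re] ≤ v * frobNorm Δ ^ 2)
    (ht : 0 < t) (hρ : 6 * ((d : ℝ) - 1) * |β| * (exp a * exp t * Real.sqrt (c * v)) + exp (a / 2) * Real.sqrt c * Λt < 1)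
    (hW : MemBallZdS a Λt t W) (hW' : MemBallZdS a Λt t (W + V')) {η Λη : ℝ} (hV' : MemBallZdS η Λη t V')
    {μ μ' : Measure (LGConfig d (Matrix.specialUnitaryGroup (Fin N) ℂ))}
    (hμ : μ ∈ perturbedGibbsMeasuresS (d := d) (fundamentalRep (Fin N)) (N * β) W)
    (hμ' : μ' ∈ perturbedGibbsMeasuresS (d := d) (fundamentalRep (Fin N)) (N * β) (W + V'))
    {F : LGConfig d (Matrix.specialUnitaryGroup (Fin N) ℂ) → ℝ} (hFm : Measurable F) {ΛF : Finset (ZdEdge d)}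
    (hFdep : DependsOn F (↑ΛF : Set (ZdEdge d))) {MF : ℝ} (hMF : ∀ σ, |F σ| ≤ MF) {δF : ZdEdge d → ℝ}
    (hδF : IsLipBound suFrobDist F δF)
    (hVm : ∀ X, Measurable (V X)) (hVdep : ∀ X, DependsOn (V X) (↑X : Set (ZdEdge d)))
    (hVb : ∀ X, ∃ C, ∀ U, |V X U| ≤ C)
    {lipV : Finset (ZdEdge d) → ZdEdge d → ℝ} (hlipV : ∀ X, IsLipBound suFrobDist (V X) (lipV X)) {L : ℝ}
    (hLs : ∀ e, Summable fun X : Finset (ZdEdge d) => (if e ∈ X then ∑ y ∈ X, lipV X y else 0))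
    (hL : ∀ e, ∑' X : Finset (ZdEdge d), (if e ∈ X then ∑ y ∈ X, lipV X y else 0) ≤ L) :
    Summable (fun X : Finset (ZdEdge d) => |cov[F, V X; μ'] - cov[F, V X; μ]|) ∧
      |∑' X : Finset (ZdEdge d), cov[F, V X; μ'] - ∑' X : Finset (ZdEdge d), cov[F, V X; μ]| ≤
        8 * N * (∑ y ∈ ΛF, δF y) *
          Real.sqrt (min η 4 / (1 - (6 * ((d : ℝ) - 1) * |β| * (exp a * exp t * Real.sqrt (c * v)) +
            exp (a / 2) * Real.sqrt c * Λt))) * L *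
          (ΛF.card * (d * ((1 + exp (-(t / 2 / d))) / (1 - exp (-(t / 2 / d)))) ^ d)) := by
  classical
  -- three real inequalities: `min ≤ geometric mean`, subadditivity of `√`, `√(e^{-tr}) = e^{-(t/2)r}`
  have min_le_sqrt : ∀ {x y : ℝ}, 0 ≤ x → 0 ≤ y → min x y ≤ Real.sqrt (x * y) := fun {x y} hx hy => by
    have hm : 0 ≤ min x y := le_min hx hy
    refine (Real.le_sqrt hm (mul_nonneg hx hy)).2 ?_
    rw [sq]
    exact mul_le_mul (min_le_left x y) (min_le_right x y) hm hx
  have sqrt_sum_le : ∀ (s : Finset (ZdEdge d)) {f : ZdEdge d → ℝ}, (∀ i ∈ s, 0 ≤ f i) →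
      Real.sqrt (∑ i ∈ s, f i) ≤ ∑ i ∈ s, Real.sqrt (f i) := fun s f hf => by
    refine (Real.sqrt_le_left (sum_nonneg fun i _ => Real.sqrt_nonneg _)).2 ?_
    calc ∑ i ∈ s, f i = ∑ i ∈ s, Real.sqrt (f i) ^ 2 := sum_congr rfl fun i hi => (Real.sq_sqrt (hf i hi)).symm
      _ ≤ (∑ i ∈ s, Real.sqrt (f i)) ^ 2 := sum_sq_le_sq_sum_of_nonneg fun i _ => Real.sqrt_nonneg _
  have sqrt_exp : ∀ r : ℝ, Real.sqrt (exp (-t * r)) = exp (-(t / 2) * r) := fun r => by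
    have h : exp (-(t / 2) * r) ^ 2 = exp (-t * r) := by
      rw [← Real.exp_nat_mul]; congr 1; push_cast; ring
    rw [← h, Real.sqrt_sq (exp_pos _).le]
  obtain ⟨BW, hBW⟩ := hW.summable
  obtain ⟨osc, lip, ℓ, hosc, hlip, hoscs, hosca, hlips, hℓ, hℓs, hℓt⟩ := hW.loads
  obtain ⟨BW', hBW'⟩ := hW'.summable
  obtain ⟨osc', lip', ℓ', hosc', hlip', hoscs', hosca', hlips', hℓ', hℓs', hℓt'⟩ := hW'.loads
  obtain ⟨ρ, hρdef⟩ : ∃ ρ : ℝ, ρ = 6 * ((d : ℝ) - 1) * |β| * (exp a * exp t * Real.sqrt (c * v)) + exp (a / 2) * Real.sqrt c * Λt :=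
    ⟨_, rfl⟩
  rw [← hρdef] at hρ ⊢
  obtain ⟨Sf, hSf⟩ : ∃ S : ℝ, S = ∑ y ∈ ΛF, δF y := ⟨_, rfl⟩
  obtain ⟨LX, hLX⟩ : ∃ LX : Finset (ZdEdge d) → ℝ, LX = fun X => ∑ y ∈ X, lipV X y := ⟨_, rfl⟩
  obtain ⟨g₁, hg₁⟩ : ∃ g₁ : ZdEdge d → ℝ, g₁ = fun e => exp (-t * linkSetDist ΛF e) := ⟨_, rfl⟩
  obtain ⟨g₂, hg₂⟩ : ∃ g₂ : ZdEdge d → ℝ, g₂ = fun e => exp (-(t / 2) * linkSetDist ΛF e) := ⟨_, rfl⟩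
  have hSf0 : 0 ≤ Sf := hSf ▸ sum_nonneg fun y _ => hδF.nonneg y
  have hLX0 : ∀ X, 0 ≤ LX X := fun X => by rw [hLX]; exact sum_nonneg fun y _ => (hlipV X).nonneg y
  have hg₁0 : ∀ e, 0 ≤ g₁ e := fun e => by rw [hg₁]; exact (exp_pos _).le
  have hg₂0 : ∀ e, 0 ≤ g₂ e := fun e => by rw [hg₂]; exact (exp_pos _).le
  have hd0 : 0 < d := hd
  have hL0 : 0 ≤ L :=
    le_trans (tsum_nonneg fun X => by split_ifs; exacts [sum_nonneg fun y _ => (hlipV X).nonneg y, le_rfl]) (hL (0, ⟨0, hd0⟩))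
  have h1ρ : 0 < 1 - ρ := sub_pos.2 hρ
  have hη0 : 0 ≤ min η 4 := by
    obtain ⟨oscV, -, -, hoscV, -, -, hoscVa, -⟩ := hV'.loads
    have h0 : (0 : ℝ) ≤ η := le_trans (tsum_nonneg fun X => by
      split_ifs
      · exact (hoscV X).nonneg _
      · exact le_rfl) (hoscVa (0, ⟨0, hd0⟩))
    exact le_min h0 (by norm_num)
  have h4N : (2 * Real.sqrt N) ^ 2 = 4 * N := by rw [mul_pow, Real.sq_sqrt (Nat.cast_nonneg N)]; norm_num
  -- (i) the decay bound, for both states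
  have hdecay : ∀ {W₀ : Potential (ZdEdge d) (Matrix.specialUnitaryGroup (Fin N) ℂ)}, MemBallZdS a Λt t W₀ →
      ∀ {ν : Measure (LGConfig d (Matrix.specialUnitaryGroup (Fin N) ℂ))},
        ν ∈ perturbedGibbsMeasuresS (d := d) (fundamentalRep (Fin N)) (N * β) W₀ →
        ∀ X, |cov[F, V X; ν]| ≤ 8 * N * Sf * LX X * ∑ e ∈ X, g₁ e := by
    intro W₀ hW₀ ν hν X
    obtain ⟨B₀, hB₀⟩ := hW₀.summable
    obtain ⟨osc₀, lip₀, ℓ₀, hosc₀, hlip₀, hoscs₀, hosca₀, hlips₀, hℓ₀, hℓs₀, hℓt₀⟩ := hW₀.loads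
    obtain ⟨CX, hCX⟩ := hVb X
    have h1 := abs_cov_le_of_isLipBound_S hd hN hc hv hb hP hVB hB₀ hW₀.continuous hW₀.dependsOn hosc₀ hoscs₀ hosca₀ hlip₀ hlips₀
      hℓ₀ ht.le hℓs₀ hℓt₀ (hρdef ▸ hρ) hν hFm hFdep hMF hδF (hVm X) (hVdep X) hCX (hlipV X)
    have hA0 : 0 ≤ 8 * N * Sf := by positivity
    simp only [hg₁]
    refine le_mul_sum_exp_of_le_mul_exp (d := d) ht.le hA0 (hLX0 X) ?_ (fun hX => ?_) (fun hΔ => ?_)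
    · calc |cov[F, V X; ν]| ≤ 2 * (2 * Real.sqrt N) ^ 2 * (∑ y ∈ X, lipV X y) * (∑ y ∈ ΛF, δF y) *
            exp (-(t * setDistEdges ΛF X)) := h1
        _ = 8 * N * Sf * LX X * exp (-(t * setDistEdges ΛF X)) := by rw [h4N, hSf, hLX]; ring
    · simp only [hLX, Finset.not_nonempty_iff_eq_empty.1 hX, sum_empty]
    · simp only [hSf, Finset.not_nonempty_iff_eq_empty.1 hΔ, sum_empty, mul_zero]
  -- (ii) the Lipschitz-in-action bound
  have hlipA : ∀ X, |cov[F, V X; μ'] - cov[F, V X; μ]| ≤ 4 * N * (min η 4 / (1 - ρ)) * Sf * LX X := fun X => by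
    have h1 := abs_cov_sub_cov_le_of_perturbation_S hd hN hc hv hb hP hVB ht.le (hρdef ▸ hρ) hW hV' hμ hμ' hFm hFdep hδF (hVm X)
      (hVdep X) (hlipV X)
    rw [← hρdef, ← hSf] at h1
    simpa only [hLX] using h1
  -- (iii) the geometric mean of the two, at half the weight
  obtain ⟨K₀, hK₀⟩ : ∃ K : ℝ, K = 8 * N * Sf * Real.sqrt (min η 4 / (1 - ρ)) := ⟨_, rfl⟩
  have hK₀0 : 0 ≤ K₀ := by rw [hK₀]; positivity
  have hsq : ∀ X, Real.sqrt (2 * (8 * N * Sf * ∑ e ∈ X, g₁ e) * (4 * N * (min η 4 / (1 - ρ)) * Sf)) ≤ K₀ * ∑ e ∈ X, g₂ e := by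
    intro X
    have hG0 : 0 ≤ ∑ e ∈ X, g₁ e := sum_nonneg fun e _ => hg₁0 e
    have heq : 2 * (8 * N * Sf * ∑ e ∈ X, g₁ e) * (4 * N * (min η 4 / (1 - ρ)) * Sf) =
        (8 * N * Sf) ^ 2 * (min η 4 / (1 - ρ)) * ∑ e ∈ X, g₁ e := by ring
    rw [heq, Real.sqrt_mul (by positivity), Real.sqrt_mul (by positivity), Real.sqrt_sq (by positivity), ← hK₀]
    refine mul_le_mul_of_nonneg_left ((sqrt_sum_le X fun e _ => hg₁0 e).trans (le_of_eq ?_)) hK₀0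
    exact sum_congr rfl fun e _ => by rw [hg₁, hg₂]; exact sqrt_exp _
  have hterm : ∀ X, |cov[F, V X; μ'] - cov[F, V X; μ]| ≤ K₀ * (LX X * ∑ e ∈ X, g₂ e) := by
    intro X
    have hG0 : 0 ≤ ∑ e ∈ X, g₁ e := sum_nonneg fun e _ => hg₁0 e
    have b1 : |cov[F, V X; μ'] - cov[F, V X; μ]| ≤ LX X * (2 * (8 * N * Sf * ∑ e ∈ X, g₁ e)) := by
      calc |cov[F, V X; μ'] - cov[F, V X; μ]| ≤ |cov[F, V X; μ']| + |cov[F, V X; μ]| := abs_sub _ _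
        _ ≤ 8 * N * Sf * LX X * ∑ e ∈ X, g₁ e + 8 * N * Sf * LX X * ∑ e ∈ X, g₁ e :=
            add_le_add (hdecay hW' hμ' X) (hdecay hW hμ X)
        _ = LX X * (2 * (8 * N * Sf * ∑ e ∈ X, g₁ e)) := by ring
    have b2 : |cov[F, V X; μ'] - cov[F, V X; μ]| ≤ LX X * (4 * N * (min η 4 / (1 - ρ)) * Sf) :=
      (hlipA X).trans (le_of_eq (by ring))
    have b3 : |cov[F, V X; μ'] - cov[F, V X; μ]| ≤
        LX X * min (2 * (8 * N * Sf * ∑ e ∈ X, g₁ e)) (4 * N * (min η 4 / (1 - ρ)) * Sf) := by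
      rcases le_total (2 * (8 * N * Sf * ∑ e ∈ X, g₁ e)) (4 * N * (min η 4 / (1 - ρ)) * Sf) with h | h
      · rw [min_eq_left h]; exact b1
      · rw [min_eq_right h]; exact b2
    calc |cov[F, V X; μ'] - cov[F, V X; μ]|
        ≤ LX X * min (2 * (8 * N * Sf * ∑ e ∈ X, g₁ e)) (4 * N * (min η 4 / (1 - ρ)) * Sf) := b3
      _ ≤ LX X * Real.sqrt (2 * (8 * N * Sf * ∑ e ∈ X, g₁ e) * (4 * N * (min η 4 / (1 - ρ)) * Sf)) :=
          mul_le_mul_of_nonneg_left (min_le_sqrt (by positivity) (by positivity)) (hLX0 X)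
      _ ≤ LX X * (K₀ * ∑ e ∈ X, g₂ e) := mul_le_mul_of_nonneg_left (hsq X) (hLX0 X)
      _ = K₀ * (LX X * ∑ e ∈ X, g₂ e) := by ring
  -- (iv) partial sums
  have hLs' : ∀ e, Summable fun X : Finset (ZdEdge d) => (if e ∈ X then LX X else 0) := fun e => by rw [hLX]; exact hLs e
  have hL' : ∀ e, ∑' X : Finset (ZdEdge d), (if e ∈ X then LX X else 0) ≤ L := fun e => by rw [hLX]; exact hL e
  have hpartial : ∀ T : Finset (Finset (ZdEdge d)), ∑ X ∈ T, |cov[F, V X; μ'] - cov[F, V X; μ]| ≤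
      K₀ * L * (ΛF.card * (d * ((1 + exp (-(t / 2 / d))) / (1 - exp (-(t / 2 / d)))) ^ d)) := by
    intro T
    have h1 : ∑ X ∈ T, |cov[F, V X; μ'] - cov[F, V X; μ]| ≤ K₀ * ∑ X ∈ T, LX X * ∑ e ∈ X, g₂ e := by
      rw [mul_sum]; exact sum_le_sum fun X _ => hterm X
    refine h1.trans ?_
    by_cases hΛF : ΛF.Nonempty
    · obtain ⟨hgs, hgt⟩ := summable_exp_neg_linkSetDist hd (half_pos ht) hΛF
      rw [← hg₂] at hgs hgt
      calc K₀ * ∑ X ∈ T, LX X * ∑ e ∈ X, g₂ e ≤ K₀ * (L * (ΛF.card * (d * ((1 + exp (-(t / 2 / d))) / (1 - exp (-(t / 2 / d)))) ^ d))) :=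
            mul_le_mul_of_nonneg_left ((sum_mul_sum_le_of_load hg₂0 hgs hLX0 hL0 hLs' hL').trans
              (mul_le_mul_of_nonneg_left hgt hL0)) hK₀0
        _ = _ := by ring
    · have hS0 : Sf = 0 := by rw [hSf, Finset.not_nonempty_iff_eq_empty.1 hΛF, sum_empty]
      have hK00 : K₀ = 0 := by rw [hK₀, hS0]; ring
      rw [hK00]; simp
  -- (v) assemble
  have hsum : Summable (fun X : Finset (ZdEdge d) => |cov[F, V X; μ'] - cov[F, V X; μ]|) :=
    summable_of_sum_le (fun _ => abs_nonneg _) hpartial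
  refine ⟨hsum, ?_⟩
  have hs : Summable (fun X : Finset (ZdEdge d) => cov[F, V X; μ]) :=
    (summable_abs_cov_direction_S hd hN hc hv hb hP hVB hBW hW.continuous hW.dependsOn hosc hoscs hosca hlip hlips hℓ ht hℓs hℓt
      (hρdef ▸ hρ) hμ hFm hFdep hMF hδF hVm hVdep hVb hlipV hLs hL).1.of_abs
  have hs' : Summable (fun X : Finset (ZdEdge d) => cov[F, V X; μ']) :=
    (summable_abs_cov_direction_S hd hN hc hv hb hP hVB hBW' hW'.continuous hW'.dependsOn hosc' hoscs' hosca' hlip' hlips' hℓ' ht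
      hℓs' hℓt' (hρdef ▸ hρ) hμ' hFm hFdep hMF hδF hVm hVdep hVb hlipV hLs hL).1.of_abs
  rw [← hs'.tsum_sub hs]
  have h1 : |∑' X : Finset (ZdEdge d), (cov[F, V X; μ'] - cov[F, V X; μ])| ≤
      ∑' X : Finset (ZdEdge d), |cov[F, V X; μ'] - cov[F, V X; μ]| := by
    have h := norm_tsum_le_tsum_norm (f := fun X : Finset (ZdEdge d) => cov[F, V X; μ'] - cov[F, V X; μ])
      (by simpa only [Real.norm_eq_abs] using hsum)
    simpa only [Real.norm_eq_abs] using h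
  refine h1.trans ((Real.tsum_le_of_sum_le (fun _ => abs_nonneg _) hpartial).trans (le_of_eq ?_))
  rw [hK₀, hSf]

end SUN

/-! ### `SU(2)`, `ℤ⁴`, uniformly on the weighted ball, hypothesis-free -/

/-- **`SU(2)`, `ℤ⁴` — THE SUSCEPTIBILITY SERIES IS HÖLDER-½ IN THE ACTION, uniformly on the weighted ball and in the direction.**  `0 < t`,
`0 ≤ η`, `0 ≤ Λ_η`, `6|β_W| e^{a+η} e^{t} + e^{(a+η)/2} √(2/3) (Λ + Λ_η) < 1` ⇒ for every member `W ∈ MemBallZdS a Λ t` (bare coupling `β_W/2`),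
every modification `V' ∈ MemBallZdS η Λ_η t`, every DLR `μ` of `W`, every DLR `μ'` of `W + V'`, every Lipschitz cylinder `F` (`Λ_F`, `K_F`) and
every direction `V` (measurable bounded own-link terms, Frobenius-Lipschitz witnesses with total load `≤ L` through every link):
`|Σ'_X cov_{μ'}(F, V_X) − Σ'_X cov_μ(F, V_X)| ≤ 16 (#Λ_F K_F) √(min(η,4)/(1 − ρ')) · L · #Λ_F · 4 · ((1 + e^{−t/8})/(1 − e^{−t/8}))⁴`,
`ρ' = 6|β_W| e^{a+η} e^{t} + e^{(a+η)/2} √(2/3) (Λ + Λ_η)` (and the termwise differences are summable). -/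
theorem su2_abs_tsum_cov_sub_tsum_cov_le_dim4 {βW a Λ t η Λη : ℝ} (ht : 0 < t) (hη : 0 ≤ η) (hΛη : 0 ≤ Λη)
    (hρ : 6 * |βW| * (exp (a + η) * exp t) + exp ((a + η) / 2) * Real.sqrt (2 / 3) * (Λ + Λη) < 1)
    {W V' V : Potential (ZdEdge 4) (Matrix.specialUnitaryGroup (Fin 2) ℂ)} (hW : MemBallZdS a Λ t W) (hV' : MemBallZdS η Λη t V')
    {μ μ' : Measure (LGConfig 4 (Matrix.specialUnitaryGroup (Fin 2) ℂ))}
    (hμ : μ ∈ perturbedGibbsMeasuresS (d := 4) (fundamentalRep (Fin 2)) (2 * (βW / 4)) W)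
    (hμ' : μ' ∈ perturbedGibbsMeasuresS (d := 4) (fundamentalRep (Fin 2)) (2 * (βW / 4)) (W + V'))
    {F : LGConfig 4 (Matrix.specialUnitaryGroup (Fin 2) ℂ) → ℝ} {ΛF : Finset (ZdEdge 4)} {KF : ℝ≥0}
    (hF : IsLipschitzCylinder (fundamentalRep (Fin 2)) F ΛF KF)
    (hVm : ∀ X, Measurable (V X)) (hVdep : ∀ X, DependsOn (V X) (↑X : Set (ZdEdge 4)))
    (hVb : ∀ X, ∃ C, ∀ U, |V X U| ≤ C)
    {lipV : Finset (ZdEdge 4) → ZdEdge 4 → ℝ} (hlipV : ∀ X, IsLipBound suFrobDist (V X) (lipV X)) {L : ℝ}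
    (hLs : ∀ e, Summable fun X : Finset (ZdEdge 4) => (if e ∈ X then ∑ y ∈ X, lipV X y else 0))
    (hL : ∀ e, ∑' X : Finset (ZdEdge 4), (if e ∈ X then ∑ y ∈ X, lipV X y else 0) ≤ L) :
    Summable (fun X : Finset (ZdEdge 4) => |cov[F, V X; μ'] - cov[F, V X; μ]|) ∧
      |∑' X : Finset (ZdEdge 4), cov[F, V X; μ'] - ∑' X : Finset (ZdEdge 4), cov[F, V X; μ]| ≤
        16 * (ΛF.card * KF) *
          Real.sqrt (min η 4 / (1 - (6 * |βW| * (exp (a + η) * exp t) + exp ((a + η) / 2) * Real.sqrt (2 / 3) * (Λ + Λη)))) * L *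
          (ΛF.card * (4 * ((1 + exp (-(t / 8))) / (1 - exp (-(t / 8)))) ^ 4)) := by
  classical
  have hc : (0 : ℝ) ≤ 2 / 3 := by norm_num
  have hP : ∀ B : Matrix (Fin 2) (Fin 2) ℂ, matrixOpNorm B ≤ |βW / 4| * (2 * (((4 : ℕ) : ℝ) - 1)) →
      ∀ (ψ : Matrix.specialUnitaryGroup (Fin 2) ℂ → ℝ) (M : ℝ), 0 ≤ M →
        (∀ x y, |ψ x - ψ y| ≤ M * suFrobDist x y) →
        Var[ψ; (haarProbability (Matrix.specialUnitaryGroup (Fin 2) ℂ)).tilted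
          fun g => ((2 : ℕ) : ℝ) * ((g : Matrix (Fin 2) (Fin 2) ℂ) * B).trace.re] ≤ 2 / 3 * M ^ 2 :=
    fun B hB ψ M hM hψ => oneLinkPoincareSUN_two_sharp _ B hB ψ M hM hψ
  have hVB := linVariance_of_poincare (N := 2) hP
  have hv : (0 : ℝ) ≤ 2 / 3 * ((2 : ℕ) : ℝ) ^ 2 := by norm_num
  have hsq : Real.sqrt (2 / 3 * (2 / 3 * ((2 : ℕ) : ℝ) ^ 2)) = 4 / 3 := by
    rw [show (2 / 3 * (2 / 3 * ((2 : ℕ) : ℝ) ^ 2) : ℝ) = (4 / 3) ^ 2 by norm_num, Real.sqrt_sq (by norm_num)]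
  have hρeq : 6 * (((4 : ℕ) : ℝ) - 1) * |βW / 4| * (exp (a + η) * exp t * Real.sqrt (2 / 3 * (2 / 3 * ((2 : ℕ) : ℝ) ^ 2))) +
      exp ((a + η) / 2) * Real.sqrt (2 / 3) * (Λ + Λη) =
      6 * |βW| * (exp (a + η) * exp t) + exp ((a + η) / 2) * Real.sqrt (2 / 3) * (Λ + Λη) := by
    rw [hsq, abs_div, abs_of_pos (by norm_num : (0 : ℝ) < 4)]
    norm_num; ring
  have hρ' : 6 * (((4 : ℕ) : ℝ) - 1) * |βW / 4| * (exp (a + η) * exp t * Real.sqrt (2 / 3 * (2 / 3 * ((2 : ℕ) : ℝ) ^ 2))) +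
      exp ((a + η) / 2) * Real.sqrt (2 / 3) * (Λ + Λη) < 1 := by rw [hρeq]; exact hρ
  have hμ₁ : μ ∈ perturbedGibbsMeasuresS (d := 4) (fundamentalRep (Fin 2)) ((2 : ℕ) * (βW / 4)) W := by simpa using hμ
  have hμ₁' : μ' ∈ perturbedGibbsMeasuresS (d := 4) (fundamentalRep (Fin 2)) ((2 : ℕ) * (βW / 4)) (W + V') := by simpa using hμ'
  have hA : ∀ a b : Matrix.specialUnitaryGroup (Fin 2) ℂ, dist (suEntries a) (suEntries b) ≤ 1 * suFrobDist a b :=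
    fun a b => by rw [one_mul]; exact dist_suEntries_le_suFrobDist a b
  have hWm : MemBallZdS (a + η) (Λ + Λη) t W := hW.mono (le_add_of_nonneg_right hη) (le_add_of_nonneg_right hΛη)
  have hWV : MemBallZdS (a + η) (Λ + Λη) t (W + V') := hW.add hV'
  have key := abs_tsum_cov_sub_tsum_cov_le_S (N := 2) (d := 4) (by norm_num) (by norm_num) hc hv le_rfl hP hVB ht hρ' hWm hWV hV'
    hμ₁ hμ₁' hF.measurable hF.dependsOn hF.abs_le (hF.isLipBound zero_le_one hA) hVm hVdep hVb hlipV hLs hL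
  rw [hρeq] at key
  refine ⟨key.1, key.2.trans (le_of_eq ?_)⟩
  have hsumF : ∑ y ∈ ΛF, (if y ∈ ΛF then (1 : ℝ) * (KF : ℝ) else 0) = ΛF.card * KF := by
    rw [Finset.sum_congr rfl fun y hy => by rw [if_pos hy, one_mul], Finset.sum_const, nsmul_eq_mul]
  rw [hsumF, show (t / 2 / ((4 : ℕ) : ℝ)) = t / 8 by push_cast; ring]
  norm_num

end Summit.Ventures.YMGap.RobustBall

end
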